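import Literature.Computability.QuantumComplexity.CompilerCodeFPBasic
import HarnessLib

/-!
# Code lengths of the braid compiler's data: norms of golden numbers, well-formed candidates

Topic `Literature/Computability/QuantumComplexity`, sequel of `CompilerCodeFPBasic.lean`
(Aharonov–Arad 2011, Thm. 3.1, §3.3). The capped loops of `CompilerCodeFP.lean` agree with the
compiler when no code exceeds the cap; to bound the codes we control the size of the entries of a
candidate's matrices by the LENGTH OF ITS WORDS: a well-formed candidate's matrix is the product of
the generator matrices along its word (`Cand.WF.mat_eq`), and an `ℓ¹`-type norm on the nested
quadratic rings is submultiplicative up to a constant.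

* `NormCalc eR` — a norm `N : R → ℕ` with `N (x + y) ≤ N x + N y`, `N (-x) = N x`,
  `N (x y) ≤ A · N x · N y` and a code bound `|eR x| ≤ α · size (N x) + β`; `NormCalc.int`, and
  **`NormCalc.qa`** (the quadratic algebra over such a ring is one), whence `k5Norm`;
* matrices: `nmax A` (the largest entry norm), `nmax_mul_le`, `nmax_prod_le` (a product of `k`
  generator matrices has `nmax ≤ n₁ (2 A G)^k`), `length_matE_le`;
* candidates: `length_rawE_letterE_le`, **`length_candE_le_of_wf`**: for a well-formed candidate,
  `|candE c| ≤ candA mat₀ · (|word| + |iword|) + candB mat₀`.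

## References

* D. Aharonov, I. Arad, New J. Phys. 13 (2011) 035019, §3.3 [AharonovArad2011].
* S. Arora, B. Barak, *Computational Complexity*, CUP 2009, §1.3 [AroraBarak2009].
-/

namespace Literature.Computability.QuantumComplexity

open Literature.Computability.Complexity Literature.Computability.Complexity.CodeFP ExactCompiler

/-! ### Norms with code bounds -/

/-- **A submultiplicative norm with a code-length bound.** [folklore] -/
structure NormCalc {R : Type} [CommRing R] (eR : R → List Bool) where
  /-- the norm -/
  N : R → ℕ
  /-- the multiplicativity constant -/
  A : ℕ
  /-- the code slope -/
  α : ℕ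
  /-- the code offset -/
  β : ℕ
  add_le : ∀ x y, N (x + y) ≤ N x + N y
  neg_eq : ∀ x, N (-x) = N x
  mul_le : ∀ x y, N (x * y) ≤ A * N x * N y
  len_le : ∀ x, (eR x).length ≤ α * Nat.size (N x) + β

namespace NormCalc

variable {R : Type} [CommRing R] {eR : R → List Bool}

/-- Differences. [folklore] -/
theorem sub_le (ν : NormCalc eR) (x y : R) : ν.N (x - y) ≤ ν.N x + ν.N y := by
  rw [sub_eq_add_neg]; exact (ν.add_le _ _).trans (by rw [ν.neg_eq])

/-- **The integers**: `N = |·|`, `A = 1`, `|intE z| ≤ 2 size |z| + 2`. [folklore] -/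
def int : NormCalc intE where
  N := Int.natAbs
  A := 1
  α := 2
  β := 2
  add_le := Int.natAbs_add_le
  neg_eq := Int.natAbs_neg
  mul_le x y := by rw [Int.natAbs_mul, one_mul]
  len_le z := by
    have h := Brick.length_dpEnc_le_two_mul z
    rw [← length_natE]; exact h

/-- The norm of the quadratic algebra: the sum of the coordinate norms. [folklore] -/
def qaN (ν : NormCalc eR) {a b : R} (z : QuadraticAlgebra R a b) : ℕ := ν.N z.re + ν.N z.im

/-- **The quadratic algebra over a normed ring is normed**, with
`A' = A + A² (N a + N b)`, `α' = 3α`, `β' = 3β + 2`. [folklore] -/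
def qa (ν : NormCalc eR) (a b : R) : NormCalc (qaE (a := a) (b := b) eR) where
  N := ν.qaN
  A := ν.A + ν.A * ν.A * (ν.N a + ν.N b)
  α := 3 * ν.α
  β := 3 * ν.β + 2
  add_le x y := by
    simp only [qaN, QuadraticAlgebra.re_add, QuadraticAlgebra.im_add]
    have h1 := ν.add_le x.re y.re; have h2 := ν.add_le x.im y.im; omega
  neg_eq x := by simp only [qaN, QuadraticAlgebra.re_neg, QuadraticAlgebra.im_neg, ν.neg_eq]
  mul_le x y := by
    simp only [qaN, QuadraticAlgebra.re_mul, QuadraticAlgebra.im_mul]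
    have e1 := (ν.add_le (x.re * y.re) (a * x.im * y.im)).trans (add_le_add (ν.mul_le x.re y.re)
      ((ν.mul_le (a * x.im) y.im).trans (Nat.mul_le_mul_right _ (Nat.mul_le_mul_left _ (ν.mul_le a x.im)))))
    have e2 := (ν.add_le (x.re * y.im + x.im * y.re) (b * x.im * y.im)).trans (add_le_add
      ((ν.add_le _ _).trans (add_le_add (ν.mul_le x.re y.im) (ν.mul_le x.im y.re)))
      ((ν.mul_le (b * x.im) y.im).trans (Nat.mul_le_mul_right _ (Nat.mul_le_mul_left _ (ν.mul_le b x.im)))))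
    refine (add_le_add e1 e2).trans ?_
    set A := ν.A; set p := ν.N x.re; set q := ν.N x.im; set r := ν.N y.re; set s := ν.N y.im; set na := ν.N a; set nb := ν.N b
    have : A * p * r + A * (A * na * q) * s + (A * p * s + A * q * r + A * (A * nb * q) * s) ≤
        (A + A * A * (na + nb)) * (p + q) * (r + s) := by nlinarith [Nat.zero_le (A * p * s), Nat.zero_le (A*q*r), Nat.zero_le (A * A * na * (p*r + p*s + q*r)), Nat.zero_le (A*A*nb*(p*r+p*s+q*r)), Nat.zero_le (A * q * s)]
    exact this
  len_le z := by
    change (pairE eR eR (z.re, z.im)).length ≤ _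
    rw [pairE_apply, length_boolPair]
    have h1 := ν.len_le z.re; have h2 := ν.len_le z.im
    have m1 : Nat.size (ν.N z.re) ≤ Nat.size (ν.qaN z) := Nat.size_le_size (Nat.le_add_right _ _)
    have m2 : Nat.size (ν.N z.im) ≤ Nat.size (ν.qaN z) := Nat.size_le_size (Nat.le_add_left _ _)
    have h1' : (eR z.re).length ≤ ν.α * Nat.size (ν.qaN z) + ν.β := h1.trans (by nlinarith)
    have h2' : (eR z.im).length ≤ ν.α * Nat.size (ν.qaN z) + ν.β := h2.trans (by nlinarith)
    nlinarith

end NormCalc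

/-- The norm structure of `ℤ[φ]`. [folklore] -/
def zphiNorm : NormCalc zphiE := NormCalc.int.qa 1 1
/-- The norm structure of `ℤ[φ][ζ₅]`. [folklore] -/
def zzNorm : NormCalc zzE := zphiNorm.qa (-1) ZPhi.tau
/-- **The norm structure of `K5`.** [folklore] -/
def k5Norm : NormCalc k5E := zzNorm.qa (QuadraticAlgebra.C ZPhi.tau) 0

/-! ### Matrices -/

/-- The largest entry norm of a `2 × 2` matrix over `K5`. [folklore] -/
def nmax (A : Matrix (Fin 2) (Fin 2) K5) : ℕ := max (max (k5Norm.N (A 0 0)) (k5Norm.N (A 0 1))) (max (k5Norm.N (A 1 0)) (k5Norm.N (A 1 1)))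

/-- Every entry is bounded by `nmax`. [folklore] -/
theorem norm_apply_le_nmax (A : Matrix (Fin 2) (Fin 2) K5) (i j : Fin 2) : k5Norm.N (A i j) ≤ nmax A := by
  unfold nmax
  fin_cases i <;> fin_cases j <;> simp

/-- **`nmax (A B) ≤ 2 A₅ · nmax A · nmax B`.** [folklore] -/
theorem nmax_mul_le (A B : Matrix (Fin 2) (Fin 2) K5) : nmax (A * B) ≤ 2 * k5Norm.A * nmax A * nmax B := by
  have key : ∀ i j, k5Norm.N ((A * B) i j) ≤ 2 * k5Norm.A * nmax A * nmax B := by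
    intro i j
    rw [Matrix.mul_apply, Fin.sum_univ_two]
    refine (k5Norm.add_le _ _).trans ?_
    have h1 := (k5Norm.mul_le (A i 0) (B 0 j)).trans (Nat.mul_le_mul (Nat.mul_le_mul_left _ (norm_apply_le_nmax A i 0)) (norm_apply_le_nmax B 0 j))
    have h2 := (k5Norm.mul_le (A i 1) (B 1 j)).trans (Nat.mul_le_mul (Nat.mul_le_mul_left _ (norm_apply_le_nmax A i 1)) (norm_apply_le_nmax B 1 j))
    nlinarith
  unfold nmax
  simp only [max_le_iff]
  exact ⟨⟨key 0 0, key 0 1⟩, ⟨key 1 0, key 1 1⟩⟩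

/-- The generator bound of an alphabet: the largest `nmax` of a generator matrix. [folklore] -/
def genBound (mat₀ : Letter → Matrix (Fin 2) (Fin 2) K5) : ℕ :=
  max (max (nmax (mat₀ Letter.x)) (nmax (mat₀ Letter.y))) (max (nmax (mat₀ Letter.xi)) (nmax (mat₀ Letter.yi)))

/-- Every generator is bounded by `genBound`. [folklore] -/
theorem nmax_mat₀_le (mat₀ : Letter → Matrix (Fin 2) (Fin 2) K5) (γ : Letter) : nmax (mat₀ γ) ≤ genBound mat₀ := by
  unfold genBound; cases γ <;> simp

/-- **A product of `k` generator matrices has `nmax ≤ nmax 1 · (2 A₅ G)^k`.** [folklore] -/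
theorem nmax_prod_le (mat₀ : Letter → Matrix (Fin 2) (Fin 2) K5) : ∀ w : List Letter,
    nmax ((w.map mat₀).prod) ≤ nmax (1 : Matrix (Fin 2) (Fin 2) K5) * (2 * k5Norm.A * genBound mat₀) ^ w.length
  | [] => by simp
  | γ :: w => by
    rw [List.map_cons, List.prod_cons, List.length_cons, pow_succ]
    have ih := nmax_prod_le mat₀ w
    have h := nmax_mul_le (mat₀ γ) ((w.map mat₀).prod)
    have hg := nmax_mat₀_le mat₀ γ
    calc nmax (mat₀ γ * (w.map mat₀).prod) ≤ 2 * k5Norm.A * nmax (mat₀ γ) * nmax ((w.map mat₀).prod) := h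
      _ ≤ 2 * k5Norm.A * genBound mat₀ * (nmax 1 * (2 * k5Norm.A * genBound mat₀) ^ w.length) := by gcongr
      _ = nmax 1 * ((2 * k5Norm.A * genBound mat₀) ^ w.length * (2 * k5Norm.A * genBound mat₀)) := by ring

/-- **The code of a matrix is linear in the size of its largest entry**: `|matE A| ≤ 9 (α₅ size (nmax A) + β₅) + 8`. [folklore] -/
theorem length_matE_le (A : Matrix (Fin 2) (Fin 2) K5) : (matE A).length ≤ 9 * (k5Norm.α * Nat.size (nmax A) + k5Norm.β) + 8 := by
  have h : ∀ i j, (k5E (A i j)).length ≤ k5Norm.α * Nat.size (nmax A) + k5Norm.β := fun i j =>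
    (k5Norm.len_le (A i j)).trans (by have := Nat.size_le_size (norm_apply_le_nmax A i j); nlinarith)
  have h00 := h 0 0; have h01 := h 0 1; have h10 := h 1 0; have h11 := h 1 1
  change (pairE (pairE k5E k5E) (pairE k5E k5E) ((A 0 0, A 0 1), (A 1 0, A 1 1))).length ≤ _
  simp only [pairE_apply, length_boolPair]
  omega

/-- The size of the largest entry of a word product is linear in the word length. [folklore] -/
theorem size_nmax_prod_le (mat₀ : Letter → Matrix (Fin 2) (Fin 2) K5) (w : List Letter) :
    Nat.size (nmax ((w.map mat₀).prod)) ≤ w.length * Nat.size (2 * k5Norm.A * genBound mat₀) + Nat.size (nmax (1 : Matrix (Fin 2) (Fin 2) K5)) + 1 := by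
  refine (Nat.size_le_size (nmax_prod_le mat₀ w)).trans ((size_mul_le _ _).trans ?_)
  have := size_pow_le (2 * k5Norm.A * genBound mat₀) w.length
  omega

/-! ### Candidates -/

/-- Letter codes have at most two bits. [folklore] -/
theorem length_letterE_le (γ : Letter) : (letterE γ).length ≤ 2 := by
  cases γ <;> simp [letterE, length_natE, Nat.size]  <;> decide

/-- `|rawE letterE w| ≤ 6 |w|`. [folklore] -/
theorem length_rawE_letterE_le (w : List Letter) : (rawE letterE w).length ≤ 6 * w.length := by
  rw [length_rawE]
  induction w with
  | nil => simp
  | cons γ w ih => rw [List.map_cons, List.sum_cons, List.length_cons]; have := length_letterE_le γ; omega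

/-- The slope of the candidate code bound. [folklore] -/
def candA (mat₀ : Letter → Matrix (Fin 2) (Fin 2) K5) : ℕ := 12 + 27 * k5Norm.α * Nat.size (2 * k5Norm.A * genBound mat₀)

/-- The offset of the candidate code bound. [folklore] -/
def candB : ℕ := 3 * (9 * (k5Norm.α * (Nat.size (nmax (1 : Matrix (Fin 2) (Fin 2) K5)) + 1) + k5Norm.β) + 8) + 6

/-- **The code of a well-formed candidate is linear in its word lengths.** [cite: AharonovArad2011, §3.3] -/
theorem length_candE_le_of_wf {mat₀ : Letter → Matrix (Fin 2) (Fin 2) K5} {c : Cand Letter} (hc : c.WF mat₀) :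
    (candE c).length ≤ candA mat₀ * (c.word.length + c.iword.length) + candB := by
  have hm := length_matE_le c.mat
  have him := length_matE_le c.imat
  have hsm := size_nmax_prod_le mat₀ c.word
  have hsim := size_nmax_prod_le mat₀ c.iword
  rw [← hc.mat_eq] at hsm; rw [← hc.imat_eq] at hsim
  have hw := length_rawE_letterE_le c.word
  have hiw := length_rawE_letterE_le c.iword
  change (pairE (rawE letterE) (pairE matE (pairE (rawE letterE) matE)) (c.word, (c.mat, (c.iword, c.imat)))).length ≤ _
  simp only [pairE_apply, length_boolPair]
  unfold candA candB
  set s := Nat.size (2 * k5Norm.A * genBound mat₀)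
  set n1 := Nat.size (nmax (1 : Matrix (Fin 2) (Fin 2) K5))
  have hm' : (matE c.mat).length ≤ 9 * (k5Norm.α * (c.word.length * s + n1 + 1) + k5Norm.β) + 8 :=
    hm.trans (by have := Nat.mul_le_mul_left k5Norm.α hsm; omega)
  have him' : (matE c.imat).length ≤ 9 * (k5Norm.α * (c.iword.length * s + n1 + 1) + k5Norm.β) + 8 :=
    him.trans (by have := Nat.mul_le_mul_left k5Norm.α hsim; omega)
  nlinarith [Nat.zero_le (k5Norm.α * s * c.word.length), Nat.zero_le (k5Norm.α * s * c.iword.length)]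

end Literature.Computability.QuantumComplexity
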